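import Summits.ResolutionOfSingularities.ResolutionOfSingularities.Theorems.UniformComplexityCampaignW82ClimbAlgClosedByName
import Summits.ResolutionOfSingularities.ResolutionOfSingularities.Theorems.UniformComplexityPrimeModelTransferSubalgebraOneFibre
import Summits.ResolutionOfSingularities.ResolutionOfSingularities.Theorems.UniformComplexityPrimeModelTransferSmoothFamilySpread
import Summits.ResolutionOfSingularities.ResolutionOfSingularities.Theorems.UniformComplexityCampaignW82PencilResolutionOneFibre
import Summits.ResolutionOfSingularities.ResolutionOfSingularities.Theorems.UniformComplexityPrimeModelTransferSpecialization
import Mathlib.RingTheory.AlgebraicIndependent.Transcendental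
import HarnessLib

/-!
# [OURS · L1 W8.2 door 2] THE CRUX `PrimeModelTransfer` IS «RESOLUTION IN PENCILS, ONE CLOSED FIBRE» —
# by-name links (Theses-importing leaf)

Route `ResolutionOfSingularities/UniformComplexity`, crux `PrimeModelTransfer`
(stmt-ResolutionOfSingularities-8933). Gen 6 of this seat proved the crux slice EQUIVALENT to the
ONE-CLOSED-FIBRE family form over `𝔽̄_p` (`CampaignW82.primeModelTransfer_iff_familyResolutionOneFibre`,
p545198). THIS FILE sharpens the base to PENCILS (bases of transcendence degree `≤ 1`,
`CampaignW82.PencilResolutionOneFibre`, p546090) using the one-transcendental climb `ClimbAlgClosed p`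
(p481773; `primeModelTransferAt_iff_climbAlgClosed`, p489826) and the E7 theorem over the finitely generated
subalgebras of the target field (`PrimeModelTransfer.hasResolution_of_forall_subalgebra_oneFibre`):

* `pencilResolutionOneFibre_of_algClosedRes` — `AlgClosedRes p → PencilResolutionOneFibre k` (∀ `k` of char `p`);
* `integralRes_of_pencilResolutionOneFibre` — for ALGEBRAICALLY CLOSED `M`: `PencilResolutionOneFibre M →`
  resolution over `M` itself (the pencils over the point `Spec M`, transcendence degree `0`);
* `climbAlgClosed_of_forall_pencilResolutionOneFibre` — `(∀ M` alg. closed of char `p`, Res(`M`) `→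
  PencilResolutionOneFibre M) → ClimbAlgClosed p` (a `K`-variety, `K` algebraically closed with
  `trdeg_M K ≤ 1`, spreads over a finitely generated `M`-subalgebra `R ⊆ K`, and `trdeg_M R ≤ trdeg_M K ≤ 1`
  by `trdeg_le_of_injective`);
* `algClosedRes_iff_forall_pencilResolutionOneFibre` — **`AlgClosedRes p ↔ ∀ M` algebraically closed of
  characteristic `p`, `PencilResolutionOneFibre M`**;
* `primeModelTransferAt_iff_forall_pencilResolutionOneFibre` — **the crux slice: `PrimeModelTransferAt p ↔
  ∀ M` algebraically closed of characteristic `p`, Res(`M`) `→ PencilResolutionOneFibre M`**: «𝔽̄_p ⇒ all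
  algebraically closed fields» holds iff, over EVERY algebraically closed `M` of characteristic `p` where
  varieties are resolvable, every PENCIL of `M`-varieties (proper family over an affine `M`-curve with
  integral geometric generic fibre) acquires, after an algebraic finite-type base change of the curve, a
  proper modification flat along ONE closed fibre, an isomorphism over an open meeting it, with that
  closed fibre — an `M`-variety — smooth;
* `primeModelTransfer_iff_forall_pencilResolutionOneFibre` — the same for the route declaration.

This is the tree's closed-fibre reformulation of the kernel (`Cruxes/PrimeFieldToPerfect/KERNEL-c3.md` §1,
(5.1): «a statement about ONE-PARAMETER FAMILIES … ONE good closed fibre») for door 2, by name. Grade: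
open-problem (equivalent to the crux); the negative census of gens 3–5 applies verbatim to pencils (all its
witnesses are pencils over `M(t)`).

[OURS · LADDER-RESOLUTION L1, slot W8.2 (prime-field / universality transfer), door 2
UniformComplexity] Theorems over the summit's own route and OURS names; NOT statements of, and
attributing nothing to, Hironaka's 2017 manuscript (the OURS `Prop`s replace the role of §17 ¶2,
p.89 l.59–62). AI-written; weaker than expert review. Theses-importing LEAF (imports the by-name leaf
`…ClimbAlgClosedByName` for `primeModelTransferAt_iff_climbAlgClosed` and otherwise Theses-free modules);
nothing imports this file.
-/

noncomputable section

set_option linter.dupNamespace false -- mandated namespace of this single-conjunct summit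

open CategoryTheory CategoryTheory.Limits AlgebraicGeometry TopologicalSpace
open Literature.AlgebraicGeometry.Resolution
open Summit.ResolutionOfSingularities.ResolutionOfSingularities.Theses.UniformComplexity (PrimeModelTransfer)

namespace Summit.ResolutionOfSingularities.ResolutionOfSingularities.Theorems.CampaignW82

/-- **`AlgClosedRes p → PencilResolutionOneFibre k`** for every field `k` of characteristic `p` (strong
spreading p541728 ⇒ smooth family form ⇒ one-fibre form ⇒ its pencil restriction). [folklore] -/
theorem pencilResolutionOneFibre_of_algClosedRes (p : ℕ) [Fact p.Prime] (h : AlgClosedRes p)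
    (k : Type) [Field k] [CharP k p] : PencilResolutionOneFibre k :=
  pencilResolutionOneFibre_of_familyResolutionOneFibre
    (PrimeModelTransfer.familyResolutionOneFibre_of_smoothFamilyResolution k
      (PrimeModelTransfer.smoothFamilyResolution_of_algClosedRes p h k))

/-- **Pencils over the point already contain resolution over `M`.** For an ALGEBRAICALLY CLOSED field `M`,
`PencilResolutionOneFibre M` implies that every integral separated `M`-scheme of finite type has a
resolution: apply `PrimeModelTransfer.hasResolution_of_forall_subalgebra_oneFibre` to `k = K = M` — every
finitely generated `M`-subalgebra of `M` has transcendence degree `≤ trdeg_M M = 0 ≤ 1`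
(`trdeg_le_of_injective`). [folklore] -/
theorem integralRes_of_pencilResolutionOneFibre (M : Type) [Field M] [IsAlgClosed M]
    (h : PencilResolutionOneFibre M) :
    ∀ (X : Scheme.{0}) (f : X ⟶ Spec (.of M)), IsSeparated f → LocallyOfFiniteType f →
      QuasiCompact f → IsIntegral X → Scheme.HasResolution X := by
  intro X f hs hl hq hX
  haveI := hs; haveI := hl; haveI := hq; haveI := hX
  refine PrimeModelTransfer.hasResolution_of_forall_subalgebra_oneFibre M M
    (fun A _ _ _ ψ hψ hA 𝒳 g hg hint => h A hA ?_ 𝒳 g hg hint) X f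
  calc Algebra.trdeg M A ≤ Algebra.trdeg M M := trdeg_le_of_injective ψ hψ
    _ = 0 := trdeg_eq_zero
    _ ≤ 1 := zero_le_one

/-- **Pencils give the one-transcendental climb.** If over every algebraically closed `M` of
characteristic `p` with resolution, `PencilResolutionOneFibre M` holds, then `ClimbAlgClosed p`: for `K`
algebraically closed with `Algebra.trdeg M K ≤ 1`, a `K`-variety spreads over a finitely generated
`M`-subalgebra `R ⊆ K` with `trdeg_M R ≤ 1` (`trdeg_le_of_injective`), whose proper family is a
pencil; `PrimeModelTransfer.hasResolution_of_forall_subalgebra_oneFibre` (E7) concludes. [folklore] -/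
theorem climbAlgClosed_of_forall_pencilResolutionOneFibre {p : ℕ}
    (h : ∀ (M : Type) [Field M] [CharP M p] [IsAlgClosed M],
      (∀ (X : Scheme.{0}) (f : X ⟶ Spec (.of M)), IsSeparated f → LocallyOfFiniteType f →
          QuasiCompact f → IsIntegral X → Scheme.HasResolution X) →
        PencilResolutionOneFibre M) :
    ClimbAlgClosed p := by
  intro M _ _ _ hM K _ _ _ hK X f hs hl hq hX
  haveI := hs; haveI := hl; haveI := hq; haveI := hX
  exact PrimeModelTransfer.hasResolution_of_forall_subalgebra_oneFibre M K
    (fun A _ _ _ ψ hψ hA 𝒳 g hg hint =>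
      h M hM A hA (le_trans (trdeg_le_of_injective ψ hψ) hK) 𝒳 g hg hint) X f

/-- **`AlgClosedRes p ↔ ∀ M` algebraically closed of characteristic `p`, `PencilResolutionOneFibre M`.**
(→ `pencilResolutionOneFibre_of_algClosedRes`; ← `integralRes_of_pencilResolutionOneFibre` at each `M`.)
[folklore] -/
theorem algClosedRes_iff_forall_pencilResolutionOneFibre (p : ℕ) [Fact p.Prime] :
    AlgClosedRes p ↔ ∀ (M : Type) [Field M] [CharP M p] [IsAlgClosed M], PencilResolutionOneFibre M :=
  ⟨fun h M _ _ _ => pencilResolutionOneFibre_of_algClosedRes p h M,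
    fun h M _ _ _ X f hs hl hq hX => integralRes_of_pencilResolutionOneFibre M (h M) X f hs hl hq hX⟩

/-- **THE CRUX SLICE IS RESOLUTION IN PENCILS, ONE CLOSED FIBRE, BY NAME.** For a prime `p`:
`PrimeModelTransferAt p ↔ ∀ M` algebraically closed of characteristic `p`, (resolution of the integral
separated finite-type `M`-schemes) `→ PencilResolutionOneFibre M`. «→»: resolution over ONE algebraically
closed `M` of characteristic `p` gives `PrimeClosureRes p` by specialization to the algebraic closure of the
prime field inside `M` (`PrimeModelTransfer.integralResOver_of_integralResOver_extension`, p484634; the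
elementwise clause ⇒ algebraic via `X ^ (p ^ n) - X`), so the crux slice gives `AlgClosedRes p` and
`pencilResolutionOneFibre_of_algClosedRes` applies. «←»: `climbAlgClosed_of_forall_pencilResolutionOneFibre`
and `primeModelTransferAt_iff_climbAlgClosed` (p489826). [folklore] -/
theorem primeModelTransferAt_iff_forall_pencilResolutionOneFibre {p : ℕ} (hp : p.Prime) :
    PrimeModelTransferAt p ↔
      ∀ (M : Type) [Field M] [CharP M p] [IsAlgClosed M],
        (∀ (X : Scheme.{0}) (f : X ⟶ Spec (.of M)), IsSeparated f → LocallyOfFiniteType f →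
            QuasiCompact f → IsIntegral X → Scheme.HasResolution X) →
          PencilResolutionOneFibre M := by
  haveI : Fact p.Prime := ⟨hp⟩
  refine ⟨fun hPMT M _ _ _ hRes => ?_,
    fun h => (primeModelTransferAt_iff_climbAlgClosed hp).mpr
      (climbAlgClosed_of_forall_pencilResolutionOneFibre h)⟩
  -- resolution over ONE algebraically closed `M` of characteristic `p` gives `PrimeClosureRes p`
  have hPC : PrimeClosureRes p := by
    intro k' _ _ _ hk' X f hs hl hq hX
    letI : Algebra (ZMod p) k' := ZMod.algebra k' p
    letI : Algebra (ZMod p) M := ZMod.algebra M p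
    haveI : Algebra.IsAlgebraic (ZMod p) k' := by
      refine ⟨fun x => ?_⟩
      obtain ⟨n, hn, hx⟩ := hk' x
      have hdeg : 1 < p ^ n := Nat.one_lt_pow hn.ne' hp.one_lt
      refine ⟨Polynomial.X ^ (p ^ n) - Polynomial.X, ?_, by simp [hx]⟩
      intro h0
      have := congrArg Polynomial.natDegree h0
      rw [Polynomial.natDegree_sub_eq_left_of_natDegree_lt (by simpa using hdeg),
        Polynomial.natDegree_X_pow, Polynomial.natDegree_zero] at this
      exact (Nat.pos_of_ne_zero (by omega) |>.ne') this |>.elim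
    let ι : k' →ₐ[ZMod p] M := IsAlgClosed.lift
    letI : Algebra k' M := ι.toRingHom.toAlgebra
    haveI : PerfectField M := IsAlgClosed.perfectField M
    exact PrimeModelTransfer.integralResOver_of_integralResOver_extension k' M hRes X f hs hl hq hX
  exact pencilResolutionOneFibre_of_algClosedRes p (hPMT hPC) M

/-- **For the route declaration.** `Theses.UniformComplexity.PrimeModelTransfer` holds iff for every prime
`p` and every algebraically closed `M` of characteristic `p` over which varieties are resolvable, PENCILS of
`M`-varieties are resolvable in the one-closed-fibre sense (`PencilResolutionOneFibre M`). [folklore] -/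
theorem primeModelTransfer_iff_forall_pencilResolutionOneFibre :
    PrimeModelTransfer ↔ ∀ (p : ℕ), p.Prime →
      ∀ (M : Type) [Field M] [CharP M p] [IsAlgClosed M],
        (∀ (X : Scheme.{0}) (f : X ⟶ Spec (.of M)), IsSeparated f → LocallyOfFiniteType f →
            QuasiCompact f → IsIntegral X → Scheme.HasResolution X) →
          PencilResolutionOneFibre M := by
  change (∀ p : ℕ, p.Prime → PrimeModelTransferAt p) ↔ _
  exact forall₂_congr fun p hp => primeModelTransferAt_iff_forall_pencilResolutionOneFibre hp

/-- **Closer shape.** [folklore] -/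
theorem primeModelTransfer_of_forall_pencilResolutionOneFibre
    (h : ∀ (p : ℕ), p.Prime → ∀ (M : Type) [Field M] [CharP M p] [IsAlgClosed M],
      (∀ (X : Scheme.{0}) (f : X ⟶ Spec (.of M)), IsSeparated f → LocallyOfFiniteType f →
          QuasiCompact f → IsIntegral X → Scheme.HasResolution X) →
        PencilResolutionOneFibre M) :
    PrimeModelTransfer :=
  primeModelTransfer_iff_forall_pencilResolutionOneFibre.mpr h

end Summit.ResolutionOfSingularities.ResolutionOfSingularities.Theorems.CampaignW82

end
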